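import Literature.Probability.LatticeModels.BattleFederbushExpansion
import HarnessLib

/-!
# Summing the propagators of a spanning tree: the tree-decay lemma

Topic `Literature/Probability/LatticeModels`; a companion of `BattleFederbushExpansion.lean`.
In the bounds on the tree expansion (Benfatto–Giuliani–Mastropietro 2006, the bound (2.77) from
(2.68a): "the integration over the coordinates is done using the propagators of the spanning
tree"; Mastropietro 2008, §3.7) one sums the positions `x_v ∈ Λ` of the clusters, the root being
held fixed, against the product over the lines `ℓ = {parent, child}` of the tree of translation
invariant weights `g_ℓ(x_child - x_parent)`; peeling the leaves one gets the product of the `ℓ¹`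
norms:

`Σ_{x : x_root = a} ∏_{ℓ ∈ T} g_ℓ (x_{child ℓ} - x_{parent ℓ}) = ∏_{ℓ ∈ T} Σ_z g_ℓ(z)`.

Here the tree is given by a script (`Script root k`: points `y₀, …, y_k` added one at a time, each
with a parent among the earlier ones), the positions are tuples `x : Fin (k + 1) → G` in a finite
additive group `G` (a torus), the weight of the `t`-th line is `g t`, and the product over the
lines is the recursively defined `lineWeightProd` (`lineWeightProd_snoc`).  The identity is
`sum_lineWeightProd_eq_prod_sum`.  Everything is proved; no named fact.

## Sources

G. Benfatto, A. Giuliani, V. Mastropietro, Ann. Henri Poincaré 7 (2006), proof of Thm. 2.1, the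
bound (2.77) (`BenfattoGiulianiMastropietro2006`); V. Mastropietro, *Non-Perturbative
Renormalization* (2008), §3.7 (`Mastropietro2008`); D. C. Brydges, Les Houches 1984, §3 (tree
graph decay) (`Brydges1986`). [folklore]
-/

noncomputable section

open Finset

namespace Literature.Probability.LatticeModels

namespace BattleFederbush

namespace Script

variable {ι : Type*} {root : ι} {G : Type*} [AddCommGroup G] {R : Type*} [CommSemiring R]

/-- **The product of the line weights of a script** at positions `x : Fin (k + 1) → G`: the line
created by `snoc s i z` (child = the new point, index `last`; parent = the `i`-th point) contributes
`g_last (x_child - x_parent)`; the weights `g : Fin k → G → R` are indexed by the lines in order of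
creation. [folklore] -/
def lineWeightProd : {k : ℕ} → Script root k → (Fin k → G → R) → (Fin (k + 1) → G) → R
  | _, nil, _, _ => 1
  | _, snoc s i _, g, x =>
    lineWeightProd s (fun t => g t.castSucc) (fun m => x m.castSucc) *
      g (Fin.last _) (x (Fin.last _) - x i.castSucc)

/-- The root alone carries no line. [folklore] -/
@[simp] theorem lineWeightProd_nil (g : Fin 0 → G → R) (x : Fin 1 → G) : (nil : Script root 0).lineWeightProd g x = 1 := rfl

/-- Peeling the last line. [folklore] -/
theorem lineWeightProd_snoc {k : ℕ} (s : Script root k) (i : Fin (k + 1)) (z : ι) (g : Fin (k + 1) → G → R)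
    (x : Fin (k + 2) → G) :
    (snoc s i z).lineWeightProd g x =
      s.lineWeightProd (fun t => g t.castSucc) (fun m => x m.castSucc) * g (Fin.last _) (x (Fin.last _) - x i.castSucc) :=
  rfl

variable [Fintype G] [DecidableEq G]

/-- **The tree-decay lemma** (summing the propagators of a spanning tree): with the root held at
`a`, the sum over the positions of the points of a script of the product of the line weights is the
product of the total masses of the weights,
`Σ_{x : x₀ = a} ∏_ℓ g_ℓ(x_{child} - x_{parent}) = ∏_ℓ Σ_z g_ℓ(z)` (Benfatto–Giuliani–Mastropietro
2006, proof of (2.77); Brydges 1986, §3). [folklore] -/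
theorem sum_lineWeightProd_eq_prod_sum : {k : ℕ} → (s : Script root k) → (g : Fin k → G → R) → (a : G) →
    ∑ x ∈ univ.filter (fun x : Fin (k + 1) → G => x 0 = a), s.lineWeightProd g x = ∏ t, ∑ z, g t z
  | _, nil, g, a => by
    rw [Fintype.prod_empty, Finset.sum_filter]
    simp only [lineWeightProd_nil]
    rw [← (Equiv.funUnique (Fin 1) G).symm.sum_comp]
    simp [Equiv.funUnique, Finset.sum_ite_eq']
  | _, snoc s i z, g, a => by
    rw [Fin.prod_univ_castSucc, ← sum_lineWeightProd_eq_prod_sum s (fun t => g t.castSucc) a, Finset.sum_filter,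
      Finset.sum_filter, ← (Fin.snocEquiv fun _ => G).sum_comp, Fintype.sum_prod_type, Finset.sum_comm,
      Finset.sum_mul]
    refine Finset.sum_congr rfl fun x _ => ?_
    have h0 : ∀ w : G, Fin.snoc (α := fun _ => G) x w 0 = x 0 := fun w => Fin.snoc_castSucc (α := fun _ => G) w x 0
    simp only [Fin.snocEquiv_apply, lineWeightProd_snoc, Fin.snoc_castSucc, Fin.snoc_last, h0]
    by_cases hx : x 0 = a
    · simp only [hx, if_true]
      rw [← Finset.mul_sum, ← (Equiv.subRight (x i)).sum_comp (fun w => g (Fin.last _) w)]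
      rfl
    · simp [hx]

end Script

end BattleFederbush

end Literature.Probability.LatticeModels
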